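import Summits.BirchSwinnertonDyer.BirchSwinnertonDyer.Theorems.ClassRecordThreeEulerHalvesAtThreeKolyvaginFamilyTildeSign
import Summits.BirchSwinnertonDyer.BirchSwinnertonDyer.Theorems.ClassRecordThreeCornerAtThreeJetchevWalkEngineAbstract
import Summits.BirchSwinnertonDyer.BirchSwinnertonDyer.Theorems.ClassRecordThreeCornerAtThreeShimuraWalkFamilyDictionary
import Summits.BirchSwinnertonDyer.BirchSwinnertonDyer.Theorems.ClassRecordThreeEulerHalvesAtThreeKolyvaginFamilyBottom
import Summits.BirchSwinnertonDyer.BirchSwinnertonDyer.Theorems.ClassRecordThreeEulerHalvesAtThreeWalkSupplyAtThreeKernelGaps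
import HarnessLib

/-!
# (P2) — the per-level inequality `hlevF` of the END GLUE (`ShimuraWalk.levelSupplyAt_of_familyLevelSupply`, p598543) for a family
# of GENERALISED Kolyvagin data `d : JET.KolyvaginFamilyData W K ι n` with `d.y = ys n`, from the family-agnostic per-level ENGINE
# and CLASS-LEVEL PRODUCERS as hypotheses — the Shimura twin of this seat's `Koly.hlevAtThree_of_prop44_of_poitouTate_of_Gross1991`
# (cell `bsd-stepL`, seat `bsd-stepL-tam3-p1` g13, owner of 19109's line; `--supports stmt-BirchSwinnertonDyer-19109 --as helper`)

HONEST FRAMING. Nothing here proves BSD, J₃ or any divisibility of a CM ∕ Heegner point; the port target `LevelSupplyAtThreeB6` is NOT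
discharged — its family-specific inputs are HYPOTHESES here; no item closes; 0 classes move (T7). THEOREMS ONLY (no definition, no named
fact, no `sorry`).

WHAT. `familyLevelSupply_of_memberships`: for `W/ℚ` globally minimal, `K` imaginary quadratic with `d_K < −4` (see FINDING), `ι`, an odd
prime `p`, `τ ≠ 1` in `Aut(K/ℚ)`, a family of points `ys m ∈ E(K[m])` with a sign `ε`, and an exponent `t`, the conclusion is VERBATIM the
binder `hlevF` of corner3-p2 g8's glue RE-READ IN GROSS CURRENCY (`∀ k n d, d.y = ys n → Squarefree n → (Gross–Kolyvagin primes) →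
m(d) < k → t ≤ k → k + m(d) ≤ M_Gross(n) → t ≤ m(d)`; lane B's producers are Gross-keyed — `FrobEqFrobInfty (p^M)` — so the Zhang-keyed
`hlevF` of p598543 is not what they can discharge; the glue `LevelSupplyAt ⟸` this conclusion is the same bookkeeping WITHOUT the Zhang step). Proof = the Jetchev §6 walk: the family-agnostic ENGINE `Koly.tamagawaExponent_le_m_of_orderedFamiliesBase_of_classes`
(corner3-p2 g7, p593074; image-agnostic, Čebotarev as hypothesis `hCeb`) at `KP :=` Gross–Kolyvagin, `depth := frobDepth`, `κ s := c_k(s)`,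
`md s := ord_p(P_s)` for a family `D` of data extending the given `d` (other conductors populated by `ShimuraWalk.exists_familyData_y_eq`),
with its class-level supplies DISCHARGED as follows. CURVE-SIDE, by the tree's kernel theorems exactly as in this seat's X₀(N) supply
(`selmerSupplyAtThree_of_kernelGaps`): the global intrinsic transverse family `𝒯` (`Walk.exists_globalTransverseFamily`), `hdisj`
(`Walk.disjoint_kummer_iInf_transverseSubgroup`), `hfin`, `hPT` (`Walk.natCard_map_localization_signPart_relaxedAt` with bsd-jet's Weil
datum, `JET.kolyvaginLocalTerm_of_poitouTate`, `RingClassTransverse.dualTransported_eq_of_localTransverseFamily` — the last needs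
`d_K < −4`), the duality conjuncts `hC`∕`hdual_q`∕`hdual_ℓ` (`Walk.exists_dualityConjuncts_of_localFacts`) over the STRINGENT family
`𝒮 := JET.stringentFamily` at a carrier pair `{v₀, τ•v₀}` (a bad place moved by `τ`, parameter) whose (δ) data at each level are the
hypothesis `hcar` (= corner3-p2's `ShimuraWalk.exists_stringentCarrier_of_ncard_eq_two` at the exempted split bad prime, `ord_p c_q = t`). BOOKKEEPING, by this seat's family
adapters (`…KolyvaginFamilyTildeSign`): `hκt` ∕ `h49` from PURE memberships + the sign congruence; `hordκ` by g12's
`KolyvaginFamilyData.divOrd_le_of_pow_dvd_addOrderOf_kolyvaginClass`; `hdivfin` from the window hypothesis `h0` (the adapter runs on the multiples of `n`; `M_Gross = ∞` only at conductor `1`). FAMILY-SPECIFIC PRODUCERS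
(HYPOTHESES, the shapes lane B ∕ the (P1) seat deliver for the labelled CM family of `X_{N⁺,N⁻}`; each quantified over ALL data `d` with
`d.y = ys n`): `hCeb` (Čebotarev ∕ image input; on the SURJECTIVE slice it is VERBATIM this seat's
`Koly.exists_kolyvaginPrime_addOrderOf_localization_eq_shift W hK hp2 hρ τ hτ`, Jetchev Lemma 6.1; on the corner, g5's Čebotarev twins), `hA` (admissibility of `E(K[n]) ⊆ E(K̄)` at every depth), `hP` (invariance of `[P_n]`
mod `p^j`, `j ≤ M(n)`), `hAτ` (`τ̃`-stability), `hsign` (Gross 5.4 (1) from the labels (B3)+(B4)), `hKum`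
(Kummer membership of the ROOT classes off `n` — Gross 6.2 (1) ∕ the E⁰ receptacle ∕ complete splitting at `S`), `htr` (transverse
condition of the root classes at `n`), `hstr` (STRINGENT membership at the two carrier places — this seat's p594055 from (B6)), `h47` (McCallum 4.4
from (B5)). FINDING (for @plan ∕ the B6Defs owners): the port targets quantify over EVERY imaginary quadratic `K` of the frame, including
`ℚ(i)` (possible when `2 ∤ N`); the tree's transverse self-duality (Howard 2.1.9 (ii)) is proved under `d_K < −4`, which the CONSUMERS have
anyway (the Friedberg–Hoffstein field of the display kernels has `|d_K| > 4`) — either add `NumberField.discr K < -4` to the three targets at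
the next reshape or supply the `w_K = 4` case of `RingClassTransverse.dualTransported_eq_of_localTransverseFamily`.
References (locators only; no cited FACT declared): [cite: Jetchev2008, §3.1, Prop. 4.5–4.9, Thm. 5.1, Lemma 5.2, Lemma 6.1, Thm. 6.3,
Prop. 6.4 (pp. 814–825)] [cite: McCallumLMS1991, §4 Prop. 4.4, Cor. 4.5] [cite: GrossLMS1991, §3 (3.1)–(3.3), Prop. 5.4, §6 Prop. 6.2 (1)]
[cite: Howard2004HeegnerKolyvagin, Prop. 2.1.9, Lemma 2.7.3] [cite: MilneADT2006, Ch. I, Thm. 4.10(b)] [cite: WZhang2014, Notations (xii)].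
presearch: not applicable (assembly of tree theorems); `lean search 'familyLevelSupply_of'` → only corner3-p2's glue consumer.
Design: one theorem, no definitions; `K : Type`. Axioms: `propext`, `Classical.choice`, `Quot.sound`.
-/

set_option autoImplicit false

noncomputable section

open scoped Classical NumberField Pointwise

namespace Summit.BirchSwinnertonDyer.Rank1Residual.X11b.Three.Koly

open WeierstrassCurve IsDedekindDomain NumberField Field Literature.NumberTheory.EllipticCurves
  Literature.NumberTheory.EllipticCurves.ModularForms Literature.NumberTheory.EllipticCurves.Jetchev2008
  Literature.NumberTheory.EllipticCurves.KolyvaginCocycle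
  Literature.NumberTheory.EllipticCurves.Rank1Residual Literature.NumberTheory.GaloisRepresentations
  Literature.NumberTheory.GaloisRepresentations.DiscreteGaloisModule
  Literature.NumberTheory.GaloisCohomology Literature.NumberTheory.Automorphic
  Summit.BirchSwinnertonDyer.Rank1Residual.X11b Summit.BirchSwinnertonDyer.Rank1Residual.JET
  Summit.BirchSwinnertonDyer.Rank1Residual.JET.SelmerVocabulary
  Summit.BirchSwinnertonDyer.Rank1Residual.JET.Walk
  Summit.BirchSwinnertonDyer.BirchSwinnertonDyer.Theorems

open Summit.BirchSwinnertonDyer.BirchSwinnertonDyer.Theorems.ShimuraWalk (frobLevelIndex frobDepth natCast_le_frobDepth_iff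
  natCast_le_frobLevelIndex_iff)

-- many ∀-closed hypotheses: binder elaboration exceeds the default
set_option maxHeartbeats 800000 in
/-- **(P2): `hlevF` of `ShimuraWalk.levelSupplyAt_of_familyLevelSupply` from the family-agnostic ENGINE and class-level PRODUCERS** —
see the module docstring for the classification of the hypotheses (curve-side inputs discharged inside by kernel theorems; image input
`hCeb`; family-specific producers `hA` `hP` `hAτ` `hsign` `hKum` `htr` `hstr` `h47`; carrier `hcar`; NO non-torsion hypothesis — the window `m(n) < k` forces `ord_p(P_1) < ∞` exactly when the engine needs it). CONDITIONAL; nothing about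
any curve is asserted. [cite: Jetchev2008, Thm. 6.3, Prop. 6.4, Lemma 6.1 (pp. 822–825)] [cite: McCallumLMS1991, §4 Prop. 4.4]
[cite: GrossLMS1991, Prop. 5.4, §6 Prop. 6.2 (1)] [cite: MilneADT2006, Ch. I, Thm. 4.10(b)] -/
theorem familyLevelSupply_of_memberships
    (W : WeierstrassCurve ℚ) [W.IsElliptic] [W.IsGloballyMinimal] [NeZero (W.conductorNorm ℤ)]
    (K : Type) [Field K] [NumberField K] (hK : IsImaginaryQuadratic K) (hD : NumberField.discr K < -4)
    (ι : K →+* ℂ) [hRCF : ∀ j : ℕ, NumberField (ringClassField K ι j)]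
    (p : ℕ) [Fact p.Prime] (hp2 : p ≠ 2) (τ : K ≃ₐ[ℚ] K) (hτ : τ ≠ 1)
    (hPT : ∀ (K : Type) [Field K] [NumberField K], poitouTate_selmerStructure_duality_conj K)
    (ys : (m : ℕ) → (W.baseChange (ringClassField K ι m)).toAffine.Point) (ε : ℤ) (hε : ε = 1 ∨ ε = -1)
    (t : ℕ)
    -- CARRIER: a bad place `v₀` moved by `τ` (over the exempted split prime), and at every level `p^k ≥ p^t` the (δ) data of the
    -- STRINGENT family there (`ord_p c = t`; corner3-p2's `ShimuraWalk.exists_stringentCarrier_of_ncard_eq_two`)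
    (v₀ : HeightOneSpectrum (𝓞 K)) (hv₀ : τ • v₀ ≠ v₀)
    (hv₀N : ((W.conductorNorm ℤ : ℕ) : 𝓞 K) ∈ v₀.asIdeal) (hv₀N' : ((W.conductorNorm ℤ : ℕ) : 𝓞 K) ∈ (τ • v₀).asIdeal)
    (hcar : 1 ≤ t → ∀ (k : ℕ) (hn : ((p ^ k : ℕ) : ℤ) ≠ 0), t ≤ k →
        (∀ w, stringentFamily W K hn w ≤ (W.baseChange K).kummerSelmerStructure ((p ^ k : ℕ) : ℤ) w) ∧
        (∀ (v w : HeightOneSpectrum (𝓞 K)) (h : τ • v = w), v ∈ ({v₀, τ • v₀} : Finset _) →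
          ∀ x : galoisCohomology (((W.baseChange K).torsionGaloisModule ((p ^ k : ℕ) : ℤ)).toLocal
            (Sum.inr v : Place K)) 1,
          x ∈ stringentFamily W K hn (Sum.inr v) →
            conjActPlace W τ ((p ^ k : ℕ) : ℤ) h x ∈ stringentFamily W K hn (Sum.inr w)) ∧
        IsAddCyclic (↥((W.baseChange K).kummerSelmerStructure ((p ^ k : ℕ) : ℤ) (Sum.inr v₀)) ⧸
          (stringentFamily W K hn (Sum.inr v₀)).addSubgroupOf
            ((W.baseChange K).kummerSelmerStructure ((p ^ k : ℕ) : ℤ) (Sum.inr v₀))) ∧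
        (stringentFamily W K hn (Sum.inr v₀)).relIndex
            ((W.baseChange K).kummerSelmerStructure ((p ^ k : ℕ) : ℤ) (Sum.inr v₀)) = p ^ t)
    -- IMAGE INPUT: Čebotarev (Jetchev Lemma 6.1 ∕ its twin for the image at hand), in the engine's shape
    (hCeb : ∀ (k : ℕ), 1 ≤ k → ∀ (j : ℕ) {e : ℤ}, (e = 1 ∨ e = -1) →
      ∀ (x y : galH1Torsion (W.baseChange K) ((p ^ k : ℕ) : ℤ)),
      conjAct W τ ((p ^ k : ℕ) : ℤ) x = e • x → conjAct W τ ((p ^ k : ℕ) : ℤ) y = (-e) • y → y ≠ 0 →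
      ∀ b : ℕ, ∃ ℓ : ℕ, b < ℓ ∧ IsKolyvaginPrime (W.conductorNorm ℤ) W K p ℓ ∧
        FrobEqFrobInfty W K (p ^ (k + j)) ℓ ∧
        ∀ v : HeightOneSpectrum (𝓞 K), (ℓ : 𝓞 K) ∈ v.asIdeal →
          addOrderOf (galoisCohomology.localization
              ((W.baseChange K).torsionGaloisModule ((p ^ k : ℕ) : ℤ)) (Sum.inr v) 1 x) = addOrderOf x ∧
          addOrderOf (galoisCohomology.localization
              ((W.baseChange K).torsionGaloisModule ((p ^ k : ℕ) : ℤ)) (Sum.inr v) 1 y) = addOrderOf y)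
    -- FAMILY-SPECIFIC PRODUCERS (for every datum of the family)
    (hA : ∀ (n : ℕ) (d : KolyvaginFamilyData W K ι n), d.y = ys n → Squarefree n →
      (∀ q ∈ n.primeFactors, IsKolyvaginPrime (W.conductorNorm ℤ) W K p q) →
      ∀ j : ℕ, IsAdmissible (absoluteGaloisGroup K) d.pointsSubgroup ((p ^ j : ℕ) : ℤ))
    (hP : ∀ (n : ℕ) (d : KolyvaginFamilyData W K ι n), d.y = ys n → Squarefree n →
      (∀ q ∈ n.primeFactors, IsKolyvaginPrime (W.conductorNorm ℤ) W K p q) →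
      ∀ j : ℕ, 1 ≤ j → (j : ℕ∞) ≤ frobLevelIndex W K p n →
      d.toGeomPoints d.derivedPoint ∈ invPoints (absoluteGaloisGroup K) d.pointsSubgroup ((p ^ j : ℕ) : ℤ))
    (hAτ : ∀ (n : ℕ) (d : KolyvaginFamilyData W K ι n), d.y = ys n → Squarefree n →
      ∀ a ∈ d.pointsSubgroup, (isLiftOfAut_liftAut τ).pointsMap W a ∈ d.pointsSubgroup)
    (hsign : ∀ (n : ℕ) (d : KolyvaginFamilyData W K ι n), d.y = ys n → Squarefree n →
      (∀ q ∈ n.primeFactors, IsKolyvaginPrime (W.conductorNorm ℤ) W K p q) →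
      ∀ j : ℕ, 1 ≤ j → (j : ℕ∞) ≤ frobLevelIndex W K p n →
      ∃ B ∈ d.pointsSubgroup, (isLiftOfAut_liftAut τ).pointsMap W (d.toGeomPoints d.derivedPoint) =
        (ε * (-1) ^ n.primeFactors.card) • d.toGeomPoints d.derivedPoint + ((p ^ j : ℕ) : ℤ) • B)
    (hKum : ∀ (k n : ℕ) (d : KolyvaginFamilyData W K ι n), 1 ≤ k → d.y = ys n → Squarefree n →
      (∀ q ∈ n.primeFactors, IsKolyvaginPrime (W.conductorNorm ℤ) W K p q ∧
        FrobEqFrobInfty W K (p ^ k) q) →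
      ∀ (u : ℕ) (Q : (W.baseChange (ringClassField K ι n)).toAffine.Point)
        (hAk : IsAdmissible (absoluteGaloisGroup K) d.pointsSubgroup ((p ^ k : ℕ) : ℤ))
        (hQ : d.toGeomPoints Q ∈ invPoints (absoluteGaloisGroup K) d.pointsSubgroup ((p ^ k : ℕ) : ℤ)),
      ((p ^ u : ℕ) : ℤ) • Q = d.derivedPoint → ((u + k : ℕ) : ℕ∞) ≤ frobLevelIndex W K p n →
      ∀ v : Place K, (∀ ℓ ∈ n.primeFactors, ¬ PlaceOver K v ℓ) →
        galoisCohomology.localization ((W.baseChange K).torsionGaloisModule ((p ^ k : ℕ) : ℤ)) v 1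
          (kolyvaginClass (W.baseChange K) ((p ^ k : ℕ) : ℤ)
            ((W.baseChange K).zsmul_geomPoints_surjective_of_charZero
              (by exact_mod_cast pow_ne_zero k (Fact.out : p.Prime).ne_zero)) hAk (d.toGeomPoints Q) hQ) ∈
          (W.baseChange K).kummerSelmerStructure ((p ^ k : ℕ) : ℤ) v)
    (htr : ∀ (k n : ℕ) (d : KolyvaginFamilyData W K ι n), 1 ≤ k → d.y = ys n → Squarefree n →
      (∀ q ∈ n.primeFactors, IsKolyvaginPrime (W.conductorNorm ℤ) W K p q ∧
        FrobEqFrobInfty W K (p ^ k) q) →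
      ∀ (u : ℕ) (Q : (W.baseChange (ringClassField K ι n)).toAffine.Point)
        (hAk : IsAdmissible (absoluteGaloisGroup K) d.pointsSubgroup ((p ^ k : ℕ) : ℤ))
        (hQ : d.toGeomPoints Q ∈ invPoints (absoluteGaloisGroup K) d.pointsSubgroup ((p ^ k : ℕ) : ℤ)),
      ((p ^ u : ℕ) : ℤ) • Q = d.derivedPoint → ((u + k : ℕ) : ℕ∞) ≤ frobLevelIndex W K p n →
      ∀ ℓ ∈ n.primeFactors,
        (kolyvaginClass (W.baseChange K) ((p ^ k : ℕ) : ℤ)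
            ((W.baseChange K).zsmul_geomPoints_surjective_of_charZero
              (by exact_mod_cast pow_ne_zero k (Fact.out : p.Prime).ne_zero)) hAk (d.toGeomPoints Q) hQ) ∈
          transverseKer W K ι ((p ^ k : ℕ) : ℤ) ℓ)
    (hstr : ∀ (k : ℕ) (hn : ((p ^ k : ℕ) : ℤ) ≠ 0) (n : ℕ) (d : KolyvaginFamilyData W K ι n), 1 ≤ k → d.y = ys n →
      Squarefree n →
      (∀ q ∈ n.primeFactors, IsKolyvaginPrime (W.conductorNorm ℤ) W K p q ∧
        FrobEqFrobInfty W K (p ^ k) q) → n.primeFactors.Nonempty →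
      ∀ q₀ ∈ ({v₀, τ • v₀} : Finset (HeightOneSpectrum (𝓞 K))),
        galoisCohomology.localization ((W.baseChange K).torsionGaloisModule ((p ^ k : ℕ) : ℤ)) (Sum.inr q₀) 1
          (d.kolyvaginClass (Fact.out : p.Prime) k) ∈ stringentFamily W K hn (Sum.inr q₀))
    (h47 : ∀ (k n n' : ℕ) (d : KolyvaginFamilyData W K ι n) (d' : KolyvaginFamilyData W K ι n') (ℓ : ℕ),
      1 ≤ k → d.y = ys n → d'.y = ys n' → Squarefree n →
      (∀ q ∈ n'.primeFactors, IsKolyvaginPrime (W.conductorNorm ℤ) W K p q ∧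
        FrobEqFrobInfty W K (p ^ k) q) →
      ℓ.Prime → ¬ ℓ ∣ n → n' = n * ℓ →
      ∀ v : HeightOneSpectrum (𝓞 K), (ℓ : 𝓞 K) ∈ v.asIdeal →
      addOrderOf (galoisCohomology.localization ((W.baseChange K).torsionGaloisModule ((p ^ k : ℕ) : ℤ))
          (Sum.inr v) 1 (d'.kolyvaginClass (Fact.out : p.Prime) k)) =
        addOrderOf (galoisCohomology.localization ((W.baseChange K).torsionGaloisModule ((p ^ k : ℕ) : ℤ))
          (Sum.inr v) 1 (d.kolyvaginClass (Fact.out : p.Prime) k))) :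
    ∀ (k n : ℕ) (d : KolyvaginFamilyData W K ι n), d.y = ys n → Squarefree n →
      (∀ ℓ ∈ n.primeFactors, IsKolyvaginPrime (W.conductorNorm ℤ) W K p ℓ) →
      (if d.divOrd p < frobLevelIndex W K p n then d.divOrd p else (⊤ : ℕ∞)) < (k : ℕ∞) → t ≤ k →
      (k : ℕ∞) + (if d.divOrd p < frobLevelIndex W K p n then d.divOrd p else ⊤) ≤
        frobLevelIndex W K p n →
      (t : ℕ∞) ≤ (if d.divOrd p < frobLevelIndex W K p n then d.divOrd p else ⊤) := by
  intro k n d hdy hn hKol h0 htk hMc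
  have hp : p.Prime := Fact.out
  -- the trivial case `t = 0`
  rcases Nat.eq_zero_or_pos t with rfl | htpos
  · exact bot_le
  have ht1 : 1 ≤ t := htpos
  -- `k ≥ 1`, the level, instances
  have hk : 1 ≤ k := le_trans ht1 htk
  have hpk : ((p ^ k : ℕ) : ℤ) ≠ 0 := by exact_mod_cast pow_ne_zero k hp.ne_zero
  haveI : NeZero (p ^ k) := ⟨pow_ne_zero k hp.ne_zero⟩
  haveI : Finite (geomTorsion (W.baseChange K) ((p ^ k : ℕ) : ℤ)) :=
    finite_geomTorsion_of_neZero (W.baseChange K) (p ^ k)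
  have hτ2 : τ * τ = 1 := algEquiv_mul_self_eq_one hK τ hτ
  have hkM : (k : ℕ∞) ≤ frobLevelIndex W K p n := le_trans le_self_add hMc
  -- the admissibility predicate of the walk (the engine's subtype, GROSS depth) and its Zhang reading
  let KP : ℕ → Prop := fun q ↦ IsKolyvaginPrime (W.conductorNorm ℤ) W K p q
  let depth : ℕ → ℕ∞ := fun q ↦ frobDepth W K p q
  have hKP : ∀ q, KP q → q.Prime ∧ ¬ q ∣ W.conductorNorm ℤ ∧ (Ideal.span {(q : 𝓞 K)}).IsPrime :=
    fun q h ↦ ⟨h.1, h.2.1, h.2.2.2.2.1⟩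
  have hinf : ∀ m : ℕ, m.primeFactors.inf depth = frobLevelIndex W K p m := fun m ↦ rfl
  -- Gross depth `k` at a Kolyvagin prime, three readings
  have hfrob : ∀ {q : ℕ}, KP q → (k : ℕ∞) ≤ depth q → FrobEqFrobInfty W K (p ^ k) q :=
    fun {q} hq h ↦ (natCast_le_frobDepth_iff hq.2.2.2.2.2 k).mp h
  have hZ1 : ∀ {q : ℕ}, KP q → (k : ℕ∞) ≤ depth q →
      Zhang2014.IsKolyvaginPrime (W.conductorNorm ℤ) W K p q ∧ k ≤ Zhang2014.kolyvaginIndex W p q :=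
    fun {q} hq h ↦ zhang_isKolyvaginPrime_of_frobEqFrobInfty (W := W) (K := K) hp hk hq (hfrob hq h)
  -- Gross reading of a subtype element (the producers' currency) and Zhang reading (the tree's curve-side lemmas)
  have hG : ∀ {m : ℕ}, (Squarefree m ∧ ∀ q ∈ m.primeFactors, KP q ∧ (k : ℕ∞) ≤ depth q) →
      ∀ q ∈ m.primeFactors, IsKolyvaginPrime (W.conductorNorm ℤ) W K p q ∧ FrobEqFrobInfty W K (p ^ k) q :=
    fun hm q hq ↦ ⟨(hm.2 q hq).1, hfrob (hm.2 q hq).1 (hm.2 q hq).2⟩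
  have hZ : ∀ {m : ℕ}, (Squarefree m ∧ ∀ q ∈ m.primeFactors, KP q ∧ (k : ℕ∞) ≤ depth q) →
      ∀ q ∈ m.primeFactors, Zhang2014.IsKolyvaginPrime (W.conductorNorm ℤ) W K p q ∧
        k ≤ Zhang2014.kolyvaginIndex W p q :=
    fun hm q hq ↦ hZ1 (hm.2 q hq).1 (hm.2 q hq).2
  have hn' : Squarefree n ∧ ∀ q ∈ n.primeFactors, KP q ∧ (k : ℕ∞) ≤ depth q :=
    ⟨hn, fun q hq ↦ ⟨hKol q hq, (Finset.le_inf_iff.mp hkM) q hq⟩⟩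
  -- the family of data: `d` at `n`, any datum of the family elsewhere
  have hdata : ∀ s : {m : ℕ // Squarefree m ∧ ∀ q ∈ m.primeFactors, KP q ∧ (k : ℕ∞) ≤ depth q},
      ∃ ds : KolyvaginFamilyData W K ι s.1, ds.y = ys s.1 ∧ ∀ h : s.1 = n, h ▸ ds = d := by
    intro s
    by_cases h : s.1 = n
    · obtain ⟨m, hm⟩ := s
      simp only at h
      subst h
      exact ⟨d, hdy, fun _ ↦ rfl⟩
    · obtain ⟨ds, hds⟩ := ShimuraWalk.exists_familyData_y_eq (W := W) hK ι s.2.1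
        (fun q hq ↦ (hKP q (s.2.2 q hq).1).2.2) ys
      exact ⟨ds, hds, fun h' ↦ absurd h' h⟩
  choose D hDy hDd using hdata
  have hDn : D ⟨n, hn'⟩ = d := hDd ⟨n, hn'⟩ rfl
  -- standing inputs for the family, from the producers
  have hAD : ∀ s (j : ℕ), IsAdmissible (absoluteGaloisGroup K) (D s).pointsSubgroup ((p ^ j : ℕ) : ℤ) :=
    fun s j ↦ hA s.1 (D s) (hDy s) s.2.1 (fun q hq ↦ (s.2.2 q hq).1) j
  have hPD : ∀ s (j : ℕ), 1 ≤ j → (j : ℕ∞) ≤ frobLevelIndex W K p s.1 →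
      (D s).toGeomPoints (D s).derivedPoint ∈
        invPoints (absoluteGaloisGroup K) (D s).pointsSubgroup ((p ^ j : ℕ) : ℤ) :=
    fun s j hj hjM ↦ hP s.1 (D s) (hDy s) s.2.1 (fun q hq ↦ (s.2.2 q hq).1) j hj hjM
  have hkMs : ∀ s : {m : ℕ // Squarefree m ∧ ∀ q ∈ m.primeFactors, KP q ∧ (k : ℕ∞) ≤ depth q},
      (k : ℕ∞) ≤ frobLevelIndex W K p s.1 :=
    fun s ↦ Finset.le_inf_iff.mpr fun q hq ↦ (s.2.2 q hq).2
  -- the sign function for `ε`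
  obtain ⟨eb, heb, hebε⟩ := Walk.exists_signFunction ε hε
  -- the GLOBAL intrinsic transverse family at level `p^k`
  obtain ⟨𝒯, h𝒯, -⟩ := exists_globalTransverseFamily W ι ((p ^ k : ℕ) : ℤ)
  have h𝒯σ' : ∀ (s : {m : ℕ // Squarefree m ∧ ∀ q ∈ m.primeFactors,
        Zhang2014.IsKolyvaginPrime (W.conductorNorm ℤ) W K p q ∧ k ≤ Zhang2014.kolyvaginIndex W p q})
      (v w : HeightOneSpectrum (𝓞 K)) (h : τ • v = w), v ∈ placesDividing K s.1 →
      ∀ x : galoisCohomology (((W.baseChange K).torsionGaloisModule ((p ^ k : ℕ) : ℤ)).toLocal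
        (Sum.inr v : Place K)) 1,
      x ∈ 𝒯 (Sum.inr v) → conjActPlace W τ ((p ^ k : ℕ) : ℤ) h x ∈ 𝒯 (Sum.inr w) :=
    fun s v w h hv x hx ↦ globalTransverse_conjActPlace_mem h𝒯 τ s.2.1
      (forall_conjActPlace_mem_of_eq_iInf_transverseSubgroup W hK ι τ _ s.1) v w h hv x hx
  -- the carrier: `𝒮 :=` the stringent family, `v₀`, (δ) of order `p^t`
  obtain ⟨hS, h𝒮σ, hcyc, hidx⟩ := hcar ht1 k hpk htk
  -- the duality conjuncts (bsd-jet's Poitou–Tate packages)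
  obtain ⟨C', hC, hdual_q, hdual_ℓ⟩ := exists_dualityConjuncts_of_localFacts W (hPT K) hK ι τ hτ p k hp2
    hk h𝒯 (fun c _ _ 𝒯c h𝒯c ↦ forall_conjActPlace_mem_of_eq_iInf_transverseSubgroup W hK ι τ _ c 𝒯c h𝒯c)
    (fun c hc hcK 𝒯c h𝒯c e hμ hadd₁ hadd₂ hgal halt hnondeg inv hperf w hw ↦
      RingClassTransverse.dualTransported_eq_of_localTransverseFamily W K hK hD ι p hp2 k hk c hc
        (fun ℓ hℓ ↦ (hcK ℓ hℓ).1) (fun ℓ hℓ ↦ (hcK ℓ hℓ).2) 𝒯c h𝒯c e hμ hadd₁ hadd₂ hgal halt hnondeg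
        inv hperf w hw)
    (kolyvaginLocalTerm_of_poitouTate hPT W K hK τ hτ p k hp2 hk) eb n (stringentFamily W K hpk) hS v₀ hv₀
    hv₀N h𝒮σ hcyc hidx
  -- the ENGINE
  have hDn' : (if (D ⟨n, hn'⟩).divOrd p < n.primeFactors.inf depth then (D ⟨n, hn'⟩).divOrd p else (⊤ : ℕ∞)) =
      (if d.divOrd p < frobLevelIndex W K p n then d.divOrd p else ⊤) := by rw [hDn, hinf]
  have key := tamagawaExponent_le_m_of_orderedFamiliesBase_of_classes W K p τ k t htk KP hKP depth
    (fun j _ he x y hx hy hy0 b ↦ by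
      obtain ⟨ℓ, hb, hK', hidx, hloc⟩ := hCeb k hk j he x y hx hy hy0 b
      exact ⟨ℓ, hb, hK', (natCast_le_frobDepth_iff hK'.2.2.2.2.2 (k + j)).mpr hidx, hloc⟩) 𝒯 (stringentFamily W K hpk) hS {v₀, τ • v₀}
    (by
      intro q hq
      simp only [Finset.mem_insert, Finset.mem_singleton] at hq
      rcases hq with rfl | rfl <;> assumption)
    (fun s ↦ ((D s).kolyvaginClass hp k : galoisCohomology ((W.baseChange K).torsionGaloisModule ((p ^ k : ℕ) : ℤ)) 1))
    (fun s ↦ (D s).divOrd p) eb heb n hn' (by rw [hDn']; exact h0) (by rw [hDn']; exact hMc)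
    ?hdisj (JET.Walk.hfin_of_kummer (K := K) W hp k 𝒯) ?hPT ?hκt ?hordκ ?h47 C' hC
    (fun s hs ↦ hdual_q ⟨s.1, s.2.1, hZ s.2⟩ hs) ?h49
    (fun s ℓ hℓK hkℓ hℓs hlt hcs v hv ↦ hdual_ℓ ⟨s.1, s.2.1, hZ s.2⟩ ℓ (hZ1 hℓK hkℓ).1 (hZ1 hℓK hkℓ).2 hℓs hlt hcs v hv)
  · rw [hDn'] at key
    exact key
  case hdisj =>
    intro ℓ hℓK hkℓ _ w hw
    exact globalTransverse_disjoint_kummer h𝒯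
      (P := fun ℓ ↦ Zhang2014.IsKolyvaginPrime (W.conductorNorm ℤ) W K p ℓ ∧
        k ≤ Zhang2014.kolyvaginIndex W p ℓ)
      (fun ℓ hℓ w hw ↦ disjoint_kummer_iInf_transverseSubgroup W K hK hD ι k hℓ.1 w hw)
      (fun ℓ hℓ ↦ hℓ.1.1) ℓ (hZ1 hℓK hkℓ) w hw
  case hPT =>
    intro s ℓ hℓK hkℓ hℓs _ _ w hw b
    obtain ⟨inv, hperf, hvan, -, hSC, hconj⟩ := hPT K (p ^ k)
    have h2 : 2 ≤ p ^ k := le_trans hp.two_le (Nat.le_self_pow (by omega) p)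
    obtain ⟨e, hμ, hadd₁, hadd₂, hgal, halt, hnondeg, hτe⟩ := exists_weilDatum_liftAut W τ (p ^ k) h2
    have hs' : (if b then (1 : ℤ) else -1) = 1 ∨ (if b then (1 : ℤ) else -1) = -1 := by
      cases b <;> simp
    have hℓs' : ℓ ∉ s.1.primeFactors := fun h ↦ hℓs (Nat.dvd_of_mem_primeFactors h)
    have hsZ := hZ s.2
    exact natCard_map_localization_signPart_relaxedAt W τ p k e hμ hadd₁ hadd₂ hgal halt hnondeg hτe
      hτ2 hp2 hk inv hperf hvan hSC (hconj τ) 𝒯 s.2.1.ne_zero (h𝒯σ' ⟨s.1, s.2.1, hsZ⟩)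
      (globalTransverse_dualTransported_eq (ι := ι) h𝒯 s.2.1
        (fun 𝒯c h𝒯c inv' hperf' w' hw' ↦
          RingClassTransverse.dualTransported_eq_of_localTransverseFamily W K hK hD ι p hp2 k hk s.1 s.2.1
            (fun ℓ hℓ ↦ (hsZ ℓ hℓ).1) (fun ℓ hℓ ↦ (hsZ ℓ hℓ).2) 𝒯c h𝒯c e hμ hadd₁ hadd₂ hgal halt
            hnondeg inv' hperf' w' hw')
        inv hperf)
      hs' (fun ℓ' h1 h2 _ v' hv' hfix ↦
        kolyvaginLocalTerm_of_poitouTate hPT W K hK τ hτ p k hp2 hk ℓ' h1 h2 v' hv' hfix _ hs')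
      ℓ (hZ1 hℓK hkℓ).1 (hZ1 hℓK hkℓ).2 hℓs' w hw
  case hκt =>
    -- the adapter is run on the SUB-family over the multiples of `n` (the engine only asks `hκt` there), so that the finiteness
    -- obligation `hdivfin` at the bottom conductor `1` (the only one with `M_Gross = ∞`) arises only when `n = 1`, where it is `h0`
    rintro ⟨m, hm⟩ hns hs
    refine hκt_of_selmerMembership_family W ι (isLiftOfAut_liftAut τ) hk 𝒯
      (Adm := fun m' ↦ (Squarefree m' ∧ ∀ q ∈ m'.primeFactors, KP q ∧ (k : ℕ∞) ≤ depth q) ∧ n ∣ m')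
      (fun s ↦ D ⟨s.1, s.2.1⟩) (frobLevelIndex W K p) eb ε
      hebε (fun s j ↦ hAD ⟨s.1, s.2.1⟩ j) (fun s j hj hjM ↦ hPD ⟨s.1, s.2.1⟩ j hj hjM)
      (fun s ↦ hAτ s.1 (D ⟨s.1, s.2.1⟩) (hDy _) s.2.1.1) ?_ ?_ ?_ ⟨m, hm, hns⟩ (by rw [← hinf]; exact hs)
    · intro s j hj hjM
      exact hsign s.1 (D ⟨s.1, s.2.1⟩) (hDy _) s.2.1.1 (fun q hq ↦ (s.2.1.2 q hq).1) j hj hjM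
    · -- `M_Gross(s) = ∞` forces `s = 1` (every Gross depth is finite), hence `n = 1`, where `h0` says `ord_p(P_1) < ∞`
      intro s hM
      have hs1 : s.1 = 1 := by
        have hempty : s.1.primeFactors = ∅ := by
          by_contra hne
          obtain ⟨q, hq⟩ := Finset.nonempty_iff_ne_empty.mpr hne
          have hle : frobLevelIndex W K p s.1 ≤ frobDepth W K p q := Finset.inf_le hq
          rw [hM, top_le_iff] at hle
          have h1 : (((Zhang2014.kolyvaginIndex W p q) + 1 : ℕ) : ℕ∞) ≤ frobDepth W K p q := by rw [hle]; exact le_top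
          have h2 := ShimuraWalk.natCast_le_kolyvaginIndex_of_le_frobDepth (W := W) (K := K) hp (s.2.1.2 q hq).1 h1
          omega
        rcases Nat.primeFactors_eq_empty.mp hempty with h0' | h1
        · exact absurd h0' s.2.1.1.ne_zero
        · exact h1
      have hn1 : n = 1 := Nat.dvd_one.mp (hs1 ▸ s.2.2)
      subst hn1
      obtain ⟨m', hm', hnm'⟩ := s
      simp only at hs1
      subst hs1
      have hD1 : D ⟨1, hm'⟩ = d := hDn
      rw [hD1]
      by_cases hc : d.divOrd p < frobLevelIndex W K p 1
      · exact ne_top_of_lt hc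
      · rw [if_neg hc] at h0
        exact absurd h0 not_top_lt
    · intro s u Q hAk hQ hQP hndvd huk
      have hsG := hG s.2.1
      exact (mem_selmerGroup_selmerF_iff W _ 𝒯 s.2.1.1.ne_zero _).mpr
        ⟨hKum k s.1 (D ⟨s.1, s.2.1⟩) hk (hDy _) s.2.1.1 hsG u Q hAk hQ hQP huk,
          (globalTransverse_mem_iff h𝒯 s.2.1.1 _).mpr
            (htr k s.1 (D ⟨s.1, s.2.1⟩) hk (hDy _) s.2.1.1 hsG u Q hAk hQ hQP huk)⟩
  case hordκ =>
    intro s j hj hdvd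
    exact (D s).divOrd_le_of_pow_dvd_addOrderOf_kolyvaginClass hp hj (hAD s k) (hPD s k hk (hkMs s)) hdvd
  case h47 =>
    intro s s' ℓ hℓ hℓs hss' _ _ v hv
    exact h47 k s.1 s'.1 (D s) (D s') ℓ hk (hDy s) (hDy s') s.2.1 (hG s'.2) hℓ hℓs hss' v hv
  case h49 =>
    refine h49_of_selmerMembership_family W ι (isLiftOfAut_liftAut τ) hk 𝒯 (stringentFamily W K hpk) {v₀, τ • v₀} D
      (frobLevelIndex W K p) hkMs eb ε hebε hAD hPD (fun s ↦ hAτ s.1 (D s) (hDy s) s.2.1) ?_ n ?_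
    · intro s j hj hjM
      exact hsign s.1 (D s) (hDy s) s.2.1 (fun q hq ↦ (s.2.2 q hq).1) j hj hjM
    · -- `hsel0`: `c_k(sℓ) ∈ H_{𝓕₀(s)^λ}` place by place
      intro s s' ℓ hℓ hℓs hss' _ _ w hw
      have hs0 : s.1 ≠ 0 := s.2.1.ne_zero
      have hsZ' := hZ s'.2
      have hℓs' : ℓ ∈ s'.1.primeFactors := by
        rw [hss']; exact Nat.mem_primeFactors.mpr ⟨hℓ, dvd_mul_left ℓ s.1, mul_ne_zero hs0 hℓ.ne_zero⟩
      have hsG' := hG s'.2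
      have hℓK : IsKolyvaginPrime (W.conductorNorm ℤ) W K p ℓ := (hsG' ℓ hℓs').1
      -- the class of `P_{sℓ}` itself as a root class (`u = 0`)
      have hAk' := hAD s' k
      have hP' := hPD s' k hk (hkMs s')
      have huk0 : ((0 + k : ℕ) : ℕ∞) ≤ frobLevelIndex W K p s'.1 := by rw [Nat.zero_add]; exact hkMs s'
      have hpf : s'.1.primeFactors = s.1.primeFactors ∪ {ℓ} := by
        rw [hss', Nat.primeFactors_mul hs0 hℓ.ne_zero, hℓ.primeFactors]
      rw [(D s').kolyvaginClass_eq_cocycleClass hp k hAk' hP']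
      refine mem_relaxedAt_selmerF0_of_local W _ 𝒯 (stringentFamily W K hpk) hs0 {v₀, τ • v₀} w _
        (fun v hvs hvw _ ↦ hKum k s'.1 (D s') hk (hDy s') s'.2.1 hsG' 0 (D s').derivedPoint hAk' hP' (by simp) huk0 v ?_)
        (fun q hq _ ↦ ?_) (fun v hv _ _ ↦ ?_)
      · -- a place not over `s` and not `λ` is not over `sℓ`
        intro q hq hPO
        rw [hpf, Finset.mem_union, Finset.mem_singleton] at hq
        rcases hq with h | rfl
        · exact hvs q h hPO
        · obtain ⟨w', hww, hw'⟩ := hPO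
          subst hww
          exact hvw (congrArg Sum.inr (place_eq_of_natCast_mem_of_isPrime hℓ.ne_zero hℓK.2.2.2.2.1 w' w hw' hw))
      · -- stringent membership at the carrier places
        have hne : s'.1.primeFactors.Nonempty := ⟨ℓ, hℓs'⟩
        have := hstr k hpk s'.1 (D s') hk (hDy s') s'.2.1 hsG' hne q hq
        rwa [(D s').kolyvaginClass_eq_cocycleClass hp k hAk' hP'] at this
      · -- transverse condition at the places of `s`
        have htr' := htr k s'.1 (D s') hk (hDy s') s'.2.1 hsG' 0 (D s').derivedPoint hAk' hP' (by simp) huk0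
        have hsub : ∀ q ∈ s.1.primeFactors, q ∈ s'.1.primeFactors := fun q hq ↦ by
          rw [hpf, Finset.mem_union]; exact Or.inl hq
        exact (globalTransverse_mem_iff h𝒯 s.2.1 _).mpr (fun q hq ↦ htr' q (hsub q hq)) v hv

end Summit.BirchSwinnertonDyer.Rank1Residual.X11b.Three.Koly

end
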